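import Literature.AlgebraicGeometry.HodgeTheory.PolarizationFormTransport
import Literature.AlgebraicGeometry.HodgeTheory.PolarizationFormMonodromyInvariant
import Literature.AlgebraicGeometry.HodgeTheory.HodgeGenericTypeStabilityOfGenericPoint
import HarnessLib

/-!
# Parallel transport between two fibres carries the polarization form of one fibre to that of the
# other, up to the scalar of the traces (the intersection form is flat)

Family `hodge`, layer `Literature/AlgebraicGeometry/HodgeTheory`; proof file (theorems only, no
definition, no named fact). Written by the prover seat `hodge-nonav-prover-Ax` (g11, cell `hodge-nonav`)
for the programme «GRIFFITHS-SURFACES», brick B5b (geometric half).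

`PolarizationFormMonodromyInvariant.polarizationForm_transportFun` is the case of a LOOP at `s`. For a
path from `s` to `t` in the cohomologically trivialising `U`, the transport `γ_* : H•(X_s(ℂ); ℂ) →
H•(X_t(ℂ); ℂ)` intertwines the Lefschetz operators of the restrictions `κ_s`, `κ_t` of a global class
`K ∈ H²(𝒳(ℂ); ℂ)` (`transportFun_lefschetzOperator`) and is multiplicative (`transportFun_cupProduct`),
so by the two-space lemma `polarizationForm_map₂`:

* `polarizationForm_transportFun₂` — for traces `τ_s`, `τ_t` on the top cohomologies with
  `τ_t ∘ γ_* = c · τ_s`, **`Q_t(γ_* x, γ_* y) = c · Q_s(x, y)`** for the polarization forms of the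
  Lefschetz decompositions of `κ_s`, `κ_t`;
* `exists_trace_transportFun_eq_mul`, `exists_ne_zero_trace_transportFun_eq_mul` (appended) — the
  scalar `c` EXISTS (and is non-zero for a non-zero `τ_t`) as soon as `H²ⁿ(X_s(ℂ); ℂ)` is a line:
  two functionals on a line are proportional, transport is bijective.

## References

* [VoisinHodgeI2002] C. Voisin, Hodge Theory and Complex Algebraic Geometry I, CUP 2002, §7.1.2, §9.2.1.
* [VoisinHodgeII2003] C. Voisin, Hodge Theory and Complex Algebraic Geometry II, CUP 2003, §3.1.2.
-/

noncomputable section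

open CategoryTheory AlgebraicGeometry

namespace Literature.AlgebraicGeometry.HodgeTheory

section HodgeTheory

open Literature.AlgebraicTopology.SingularHomology Literature.Geometry.Kaehler

section Family

variable {𝒳 S : Motives.SchemeOver ℂ} (f : 𝒳 ⟶ S) {U : Set (Motives.ComplexPoints S)}
  (hU : IsCohomologicallyLocallyTrivialOn f U)

/-- **The polarization form is flat up to the scalar of the traces.** For `K ∈ H²(𝒳(ℂ); ℂ)` whose
restrictions `κ_s = K|_{X_s}`, `κ_t = K|_{X_t}` have the hard Lefschetz property in dimension `n`,
traces `τ_s`, `τ_t` with `τ_t (γ_* z) = c · τ_s z` on `H²ⁿ`, and a path class `γ` from `s` to `t`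
in `U`: `Q_{κ_t,τ_t}(γ_* x, γ_* y) = c · Q_{κ_s,τ_s}(x, y)` in every degree `i`.
[cite: VoisinHodgeI2002, §7.1.2 and §9.2.1] [cite: VoisinHodgeII2003, §3.1.2] -/
theorem polarizationForm_transportFun₂ (K : complexBetti 𝒳 2) {n : ℕ} {s t : U}
    (hLs : HasHardLefschetzProperty (complexBetti.map (Motives.fiberι f s.1) 2 K) n)
    (hvans : ∀ m, 2 * n < m →
      Subsingleton (singularCohomology ℂ ℂ (Motives.ComplexPoints (Motives.fiberOver f s.1)) m))
    (hLt : HasHardLefschetzProperty (complexBetti.map (Motives.fiberι f t.1) 2 K) n)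
    (hvant : ∀ m, 2 * n < m →
      Subsingleton (singularCohomology ℂ ℂ (Motives.ComplexPoints (Motives.fiberOver f t.1)) m))
    (τs : complexBetti (Motives.fiberOver f s.1) (2 * n) →ₗ[ℂ] ℂ)
    (τt : complexBetti (Motives.fiberOver f t.1) (2 * n) →ₗ[ℂ] ℂ) (c : ℂ)
    (γ : Path.Homotopic.Quotient s t)
    (hτ : ∀ z, τt (transportFun f (2 * n) hU γ z) = c * τs z)
    {i : ℕ} (x y : complexBetti (Motives.fiberOver f s.1) i) :
    polarizationForm (complexBetti.map (Motives.fiberι f t.1) 2 K) n hLt hvant τt i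
        (transportFun f i hU γ x) (transportFun f i hU γ y) =
      c * polarizationForm (complexBetti.map (Motives.fiberι f s.1) 2 K) n hLs hvans τs i x y := by
  have h := polarizationForm_map₂ (fun a ↦ (transportLinear f a hU γ).toAddMonoidHom)
    (fun k l h x ↦ transportFun_lefschetzOperator f hU K γ h x) hLs hvans hLt hvant τs τt c
    (fun p q r h x y ↦ transportFun_cupProduct f hU h γ x y) hτ x y
  simpa only [LinearMap.toAddMonoidHom_coe, transportLinear_apply] using h

/-- Two linear functionals on a line, the second non-zero, are proportional (local copy of the tree's
`exists_eq_smul_of_finrank_eq_one` of `BettiUniverseTraceIntegral`, to keep the import cone small).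
[folklore] -/
private theorem exists_eq_smul_of_finrank_eq_one' {K V : Type*} [Field K] [AddCommGroup V] [Module K V]
    (h1 : Module.finrank K V = 1) (φ ψ : V →ₗ[K] K) (hψ : ψ ≠ 0) : ∃ c : K, φ = c • ψ := by
  obtain ⟨v, hv⟩ := DFunLike.ne_iff.1 hψ
  rw [LinearMap.zero_apply] at hv
  have hv0 : v ≠ 0 := fun h ↦ hv (by rw [h, map_zero])
  refine ⟨φ v / ψ v, LinearMap.ext fun w ↦ ?_⟩
  obtain ⟨a, rfl⟩ := (finrank_eq_one_iff_of_nonzero' v hv0).1 h1 w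
  rw [LinearMap.smul_apply, map_smul, map_smul, smul_eq_mul, smul_eq_mul, smul_eq_mul]
  field_simp

/-- **The scalar of the traces exists**: if `H²ⁿ(X_s(ℂ); ℂ)` is a line (`X_s` smooth projective of
dimension `n`: `finrank_complexBetti_two_mul_eq_one`), then for any traces `τ_s ≠ 0` on `H²ⁿ(X_s)` and
`τ_t` on `H²ⁿ(X_t)` there is `c` with `τ_t (γ_* z) = c · τ_s z` (two functionals on a line).
[cite: VoisinHodgeI2002, §7.1.2] -/
theorem exists_trace_transportFun_eq_mul {n : ℕ} {s t : U}
    (h1 : Module.finrank ℂ (complexBetti (Motives.fiberOver f s.1) (2 * n)) = 1)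
    (γ : Path.Homotopic.Quotient s t)
    (τs : complexBetti (Motives.fiberOver f s.1) (2 * n) →ₗ[ℂ] ℂ) (hτs : τs ≠ 0)
    (τt : complexBetti (Motives.fiberOver f t.1) (2 * n) →ₗ[ℂ] ℂ) :
    ∃ c : ℂ, ∀ z, τt (transportFun f (2 * n) hU γ z) = c * τs z := by
  obtain ⟨c, hc⟩ := exists_eq_smul_of_finrank_eq_one' h1 (τt ∘ₗ transportLinear f (2 * n) hU γ) τs hτs
  refine ⟨c, fun z ↦ ?_⟩
  have h := LinearMap.congr_fun hc z
  rw [LinearMap.comp_apply, transportLinear_apply, LinearMap.smul_apply, smul_eq_mul] at h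
  exact h

/-- **… and it is non-zero for a non-zero `τ_t`** (transport is bijective: `γ_* ∘ (γ⁻¹)_* = id`).
[cite: VoisinHodgeI2002, §7.1.2 and §9.2.1] -/
theorem exists_ne_zero_trace_transportFun_eq_mul {n : ℕ} {s t : U}
    (h1 : Module.finrank ℂ (complexBetti (Motives.fiberOver f s.1) (2 * n)) = 1)
    (γ : Path.Homotopic.Quotient s t)
    (τs : complexBetti (Motives.fiberOver f s.1) (2 * n) →ₗ[ℂ] ℂ) (hτs : τs ≠ 0)
    (τt : complexBetti (Motives.fiberOver f t.1) (2 * n) →ₗ[ℂ] ℂ) (hτt : τt ≠ 0) :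
    ∃ c : ℂ, c ≠ 0 ∧ ∀ z, τt (transportFun f (2 * n) hU γ z) = c * τs z := by
  obtain ⟨c, hc⟩ := exists_trace_transportFun_eq_mul f hU h1 γ τs hτs τt
  refine ⟨c, fun hc0 ↦ hτt (LinearMap.ext fun w ↦ ?_), hc⟩
  have h := hc (transportFun f (2 * n) hU γ.symm w)
  rw [transportFun_transportFun_symm, hc0, zero_mul] at h
  rw [h, LinearMap.zero_apply]

end Family

end HodgeTheory

end Literature.AlgebraicGeometry.HodgeTheory

end
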